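import Summits.BirchSwinnertonDyer.Rank1Residual.X1.FactorSqueeze
import HarnessLib

/-!
# Route N with Greenberg's `hb` in place of the typed lower bound: the factorisation squeeze needs
# only `λ_alg ≥ 1`, and `λ_alg ≥ 1` is a THEOREM at a leaf pair with
# `m + 2·ord_p #E(ℚ)_tors < ord_p ∏ c_ℓ + 2·ord_p #Ẽ(𝔽_p)`

HONEST FRAMING (cell `b2b-bsdres`, run/shared/lean/b2b/bsd-rank1-residual/, verbatim in every
file): the goal of the cell is to DELETE the COMBINATION-SHAPED residual classes of the
Birch–Swinnerton-Dyer formula for ALL analytic-rank `≤ 1` elliptic curves over `ℚ` — "full BSD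
formula for every rank `≤ 1` curve in class `C`" assembled STRICTLY from published theorems — so
that the rank-`≤ 1` remainder becomes exactly the CONSTRUCTION-SHAPED classes, which are TYPED
(missing-input `Prop`s), NOT attempted. This is not "finishing BSD". Sub-cell
`b2b-bsdres-eisenstein-p1` (CLASS-OWNERS row "X1 (r=0)"), gen 11: research route; NO CLAIM BEYOND
STATED CLASSES; nothing here changes a label. NO definition; theorems over the PUBLISHED named facts
Wuthrich 2014 Thm. 16 (`hW16`), Greenberg 1999 Thm. 4.1 (`hGr`), Prop. 3.10 (`h310`), modularity
(`hmod`), Gross–Zagier–Kolyvagin (`hGZK`) and the cell's typed per-pair inputs `AnalyticMuLE`,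
`AnalyticLambdaEq`, `AnalyticLamDivisorSet` (route N, `X1/FactorSqueeze.lean`).

WHY THIS FILE. `X1/FactorSqueeze.lean` closes Mazur's main conjecture from the factorisation pattern
`A` of the analytic distinguished polynomial, a lower bound `λ_alg ≥ k` supplied as the TYPED input
`AlgebraicLambdaGE W p k` (route T's Tamagawa tower count, or route D's descent), and the gap check.
In the gen-10 census 594 of the 733 route-N closures at `N < 2·10⁴` pass the gap check already with
`k = 1` (480 with `P_an` irreducible, 114 by parity, e.g. two irreducible cubics), and `λ_alg ≥ 1`
needs no typed input at all: it is Greenberg's Thm. 4.1 read on the constant term, exactly as in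
route P (`X1/ParitySqueeze.lean`): with `ϖ·L_p = ι(f_E·h)`, `μ(f_E) ≤ μ(f_E·h) ≤ m` and
`hb : m + 2·ord_p #E(ℚ)_tors < ord_p ∏ c_ℓ + 2·ord_p #Ẽ(𝔽_p)`, the valuation `ord_p f_E(0) = ord_p ∏c +
2 ord_p #Ẽ(𝔽_p)(p) + ord_p #Sel − 2 ord_p #E(ℚ)(p) > m ≥ μ(f_E)` forbids `λ(f_E) = 0` (which would
give `ord_p f_E(0) = μ(f_E)`). §1 extracts that step as a lemma (`one_le_lam_generator_of_hb`); §2–§3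
are the `k = 1` forms of route N with `hb` replacing `AlgebraicLambdaGE W p 1`, so those 594 closures
(and e.g. the N1″ cell `448286d@5`, `P_an` irreducible) rest on PUBLISHED facts + the analytic
pattern + integers of Cremona's table (`#E(ℚ)_tors`, `∏ c_ℓ`, `#Ẽ(𝔽_p)`), with no single-engine
Tamagawa-tower input.

* §1 `one_le_lam_generator_of_hb` (PROVED; the route-P step as a lemma).
* §2 `lambdaPartAt_of_lamDivisorSet_of_even_of_hb`, `mazurMainConjecture_of_lamDivisorSet_of_even_of_hb`.
* §3 `Leaf.bsdp_of_lamDivisorSet_of_hb`, `Leaf.bsdp_of_muZero_of_lamDivisorSet_of_hb`,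
  `Leaf.bsdp_of_muZero_of_irreducible_of_hb`, `…_of_dvd_tamagawaProduct`, `…_of_not_dvd_torsionOrder`.

References: [GreenbergLNM1716] Prop. 3.10, Thm. 4.1 (p. 102), §5 pp. 131, 183; [Wuthrich2014]
Thm. 16; [Washington1997] Thm. 7.3 / Prop. 7.6 (shape of the typed pattern);
HOME/b2b-bsdres-eisenstein-p1/X1R0-GAPMAP.md §19–§20.
-/

noncomputable section

open scoped Classical MatrixGroups ModularForm

open PowerSeries CongruenceSubgroup WeierstrassCurve Literature.NumberTheory.EllipticCurves
  Literature.NumberTheory.EllipticCurves.ModularForms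
  Literature.NumberTheory.EllipticCurves.Rank1Residual
  Literature.NumberTheory.EllipticCurves.Greenberg1999
  Summit.BirchSwinnertonDyer.BirchSwinnertonDyer.Theorems.Rank1ResidualX1Defs
  Summit.BirchSwinnertonDyer.Rank1Residual.X1.MuLambda
  Summit.BirchSwinnertonDyer.Rank1Residual.X1.MuPart
  Summit.BirchSwinnertonDyer.Rank1Residual.X1.ParitySqueeze
  Summit.BirchSwinnertonDyer.Rank1Residual.X1.TamagawaSqueeze
  Summit.BirchSwinnertonDyer.Rank1Residual.X1.FactorSqueeze

set_option autoImplicit false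

namespace Summit.BirchSwinnertonDyer.Rank1Residual.X1.FactorSqueezeHb

/-! ## §1. `λ(f_E) ≥ 1` from Greenberg's Thm. 4.1 and `hb` (the route-P step, as a lemma) -/

section LowerBound

variable {W : WeierstrassCurve ℚ} [W.IsElliptic] [W.IsGloballyMinimal] {p : ℕ} [Fact p.Prime]

/-- **`λ(f_E) ≥ 1` from `hb`.** `W/ℚ` globally minimal elliptic, `p ≠ 2` good ordinary,
`L(E,1) ≠ 0`; cyclotomic data `κ, γ` (cyclotomic variable), newform `f`, `ϖ·Ω_E = Ω⁺_f`, a torsion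
dual datum `D` with `char X = (f_E)` and `ι(f_E·h) = ϖ·L_p(f,α)`. If `μ(f_E·h) ≤ m` and
`hb : m + 2·ord_p #E(ℚ)_tors < ord_p ∏ c_ℓ + 2·ord_p #Ẽ(𝔽_p)`, then `1 ≤ λ(f_E)`: the constant term
`f_E(0)·h(0) = ϖ(1 − α⁻¹)²[0]⁺_f ≠ 0` (interpolation), so `Sel_{p^∞}(E/ℚ)` is finite and Greenberg's
Thm. 4.1 (`hGr`) gives `ord_p f_E(0) = ord_p ∏c + 2 ord_p #Ẽ(𝔽_p)(p) + ord_p #Sel − 2 ord_p #E(ℚ)(p) > m`,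
whereas `λ(f_E) = 0` would force `ord_p f_E(0) = μ(f_E) ≤ μ(f_E·h) ≤ m`
(`ParitySqueeze.valuation_constantCoeff_of_lam_eq_zero`). [cite: GreenbergLNM1716, Thm. 4.1 (p. 102), §5 p. 183]
[cite: MazurTateTeitelbaum1986Invent, §I.14 (14.3)] -/
theorem one_le_lam_generator_of_hb (hGr : greenberg_charValue_rankZero)
    (hp : p ≠ 2) (hgood : W.HasGoodReductionAtPrime p) (hord : ¬ (p : ℤ) ∣ W.frobeniusTrace p)
    (hL : W.entireLFunction 1 ≠ 0) {κ : ZpExtension ℚ p} {γ : Field.absoluteGaloisGroup ℚ}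
    (hκ : κ.IsCyclotomic) (hγ : κ.IsTopGenerator γ) (hγ' : IsCyclotomicVariable p γ)
    [NeZero (W.conductorNorm ℤ)] {f : CuspForm (Gamma0 (W.conductorNorm ℤ)) 2} (hf : IsNewformOf W f)
    {ϖ : ℚ} (hϖ : (ϖ : ℝ) * W.realPeriodRat = plusPeriod f) (D : W.SelmerDualData κ γ)
    [Module.Finite (IwasawaAlgebra p) D.X] (hX : D.IsTorsion) {fE h : IwasawaAlgebra p}
    (hchar : D.charIdeal = Ideal.span {fE})
    (hι : iwasawaToPowerSeries p (fE * h) = C (ϖ : ℚ_[p]) * padicLFunction f (unitRoot W p : ℚ_[p]))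
    {m : ℕ} (hμm : mu (fE * h) ≤ m)
    (hb : m + 2 * padicValNat p W.torsionOrder <
      padicValNat p W.tamagawaProduct + 2 * padicValNat p (W.reductionPointCount p)) :
    1 ≤ lam fE := by
  have hpP : p.Prime := Fact.out
  have hordp : IsOrdinaryAt W p := ⟨hgood, hord⟩
  have hg0 : fE * h ≠ 0 := mul_ne_zero_of_iota_eq hgood hord hf hϖ D hι
  have hfE0 : fE ≠ 0 := fun e ↦ hg0 (by rw [e, zero_mul])
  have hh0 : h ≠ 0 := fun e ↦ hg0 (by rw [e, mul_zero])
  -- the constant term of `ϖ · L_p` is `ϖ (1 - α⁻¹)² [0]⁺_f ≠ 0`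
  set a : ℚ_[p] := ((unitRoot W p : ℤ_[p]) : ℚ_[p]) with ha
  set s : ℚ := ratPlusSymbol f 0 with hs_def
  have hs0 : s ≠ 0 := by
    intro h0
    apply hL
    rw [hf.entireLFunction_one_eq, ← hs_def, h0]
    simp
  have hϖ0 : ϖ ≠ 0 := varpi_ne_zero hf hϖ
  have hg0c : ((constantCoeff (fE * h) : ℤ_[p]) : ℚ_[p]) =
      (ϖ : ℚ_[p]) * ((1 - a⁻¹) ^ 2 * (s : ℚ_[p])) := by
    rw [← constantCoeff_iwasawaToPowerSeries p (fE * h), hι, map_mul, constantCoeff_C,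
      constantCoeff_padicLFunction_unitRoot hordp hf]
  obtain ⟨u₂, hu₂⟩ := exists_unit_one_sub_unitRoot_inv p W hordp
  haveI : NeZero p := ⟨hpP.ne_zero⟩
  obtain ⟨u₃, hu₃⟩ := exists_unit_natCard_eq_mul_card_primaryComponent
    ((integralModelInt W).map (Int.castRingHom (ZMod p))).toAffine.Point p
  set Np : ℚ_[p] := (Nat.card (AddCommGroup.primaryComponent
    ((integralModelInt W).map (Int.castRingHom (ZMod p))).toAffine.Point p) : ℚ_[p]) with hNp
  have hNcount : (W.reductionPointCount p : ℚ_[p]) = ((u₃ : ℤ_[p]) : ℚ_[p]) * Np := by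
    rw [WeierstrassCurve.reductionPointCount, hNp]
    exact hu₃
  have hNp0 : Np ≠ 0 := by rw [hNp]; exact_mod_cast Nat.card_pos.ne'
  have h1 : (1 - a⁻¹) = ((u₂ : ℤ_[p]) : ℚ_[p]) * ((u₃ : ℤ_[p]) : ℚ_[p]) * Np := by
    rw [hu₂, hNcount, mul_assoc]
  have h1ne : (1 - a⁻¹) ≠ 0 := by
    rw [h1]
    exact mul_ne_zero (mul_ne_zero (coe_units_ne_zero p u₂) (coe_units_ne_zero p u₃)) hNp0
  have hg00 : constantCoeff (fE * h) ≠ 0 := by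
    intro h0
    rw [h0, PadicInt.coe_zero] at hg0c
    have : (ϖ : ℚ_[p]) * ((1 - a⁻¹) ^ 2 * (s : ℚ_[p])) ≠ 0 :=
      mul_ne_zero (by exact_mod_cast hϖ0) (mul_ne_zero (pow_ne_zero 2 h1ne) (by exact_mod_cast hs0))
    exact this hg0c.symm
  have hfE00 : constantCoeff fE ≠ 0 := by
    intro h0; apply hg00; rw [map_mul, h0, zero_mul]
  -- `Sel_{p^∞}(E/ℚ)` is finite
  have hSelfin : Finite (W.selmerGroupPInfty p) :=
    D.finite_selmerGroupPInfty_of_constantCoeff_ne_zero W hγ hX fE hchar hfE00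
  obtain ⟨hEfin, -⟩ := (W.finite_selmerGroupPInfty_iff p).mp hSelfin
  haveI := hEfin
  -- `λ(fE) ≠ 0`: otherwise `ord_p fE(0) = μ(fE) ≤ m`, contradicting Thm. 4.1 and `hb`
  have hne : lam fE ≠ 0 := by
    apply lam_ne_zero_of_valuation_constantCoeff_ne hfE0
    right
    intro hval
    obtain ⟨u₁, hu₁⟩ := hGr W p hp hgood hord κ γ hκ hγ hγ' D hX fE hchar hSelfin
    obtain ⟨u₄, hu₄⟩ := exists_unit_torsionOrder_eq W p
    set v := padicValNat p W.tamagawaProduct with hv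
    set Tp : ℚ_[p] := (Nat.card (AddCommGroup.primaryComponent W.toAffine.Point p) : ℚ_[p]) with hTp
    set f0 : ℚ_[p] := ((constantCoeff fE : ℤ_[p]) : ℚ_[p]) with hf0
    have hf0ne : f0 ≠ 0 := by rw [hf0]; exact PadicInt.coe_ne_zero.mpr hfE00
    have hTp0 : Tp ≠ 0 := by rw [hTp]; exact_mod_cast Nat.card_pos.ne'
    have hp0 : (p : ℚ_[p]) ≠ 0 := Nat.cast_ne_zero.mpr hpP.ne_zero
    have hSel0 : (Nat.card (W.selmerGroupPInfty p) : ℚ_[p]) ≠ 0 := by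
      haveI := hSelfin
      exact_mod_cast Nat.card_pos.ne'
    have hu₄' : (W.torsionOrder : ℚ_[p]) = ((u₄ : ℤ_[p]) : ℚ_[p]) * Tp := by
      rw [hu₄, hTp]
      congr 1
      exact_mod_cast natCard_primaryComponent_point_congr W p _ _
    have hval1 := congrArg Padic.valuation hu₁
    rw [Padic.valuation_mul hf0ne (pow_ne_zero 2 hTp0), Padic.valuation_pow,
      Padic.valuation_mul (mul_ne_zero (mul_ne_zero (coe_units_ne_zero p u₁) (pow_ne_zero v hp0))
        (pow_ne_zero 2 hNp0)) hSel0,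
      Padic.valuation_mul (mul_ne_zero (coe_units_ne_zero p u₁) (pow_ne_zero v hp0))
        (pow_ne_zero 2 hNp0),
      Padic.valuation_mul (coe_units_ne_zero p u₁) (pow_ne_zero v hp0), valuation_coe_units_eq_zero,
      Padic.valuation_pow, Padic.valuation_pow, Padic.valuation_p] at hval1
    have hvT : Tp.valuation = (padicValNat p W.torsionOrder : ℤ) := by
      have e := congrArg Padic.valuation hu₄'
      rw [Padic.valuation_natCast, Padic.valuation_mul (coe_units_ne_zero p u₄) hTp0,
        valuation_coe_units_eq_zero, zero_add] at e
      exact e.symm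
    have hvN : Np.valuation = (padicValNat p (W.reductionPointCount p) : ℤ) := by
      have e := congrArg Padic.valuation hNcount
      rw [Padic.valuation_natCast, Padic.valuation_mul (coe_units_ne_zero p u₃) hNp0,
        valuation_coe_units_eq_zero, zero_add] at e
      exact e.symm
    rw [hvT, hvN] at hval1
    have hμfE : mu fE ≤ m := (mu_le_mu_mul hfE0 hh0).trans hμm
    have hval' : f0.valuation = (mu fE : ℤ) := by rw [hf0]; exact hval
    rw [hval'] at hval1
    have hSelv : 0 ≤ (Nat.card (W.selmerGroupPInfty p) : ℚ_[p]).valuation := by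
      rw [Padic.valuation_natCast]; exact_mod_cast Nat.zero_le _
    simp only [Nat.cast_ofNat] at hval1
    have hb' : (m : ℤ) + 2 * (padicValNat p W.torsionOrder : ℤ) <
        (padicValNat p W.tamagawaProduct : ℤ) + 2 * (padicValNat p (W.reductionPointCount p) : ℤ) := by
      exact_mod_cast hb
    have hμfE' : (mu fE : ℤ) ≤ m := by exact_mod_cast hμfE
    linarith
  omega

end LowerBound

/-! ## §2. Route N with `hb`: the λ-part and Mazur's main conjecture -/

section Squeeze

variable {W : WeierstrassCurve ℚ} [W.IsElliptic] [W.IsGloballyMinimal] {p : ℕ} [Fact p.Prime]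

/-- **Route N, λ-part with parity and `hb` (no typed lower bound).** `W/ℚ` globally minimal elliptic,
`p ≠ 2` good ordinary with `E[p]` reducible, `L(E,1) ≠ 0`; granted Wuthrich Thm. 16 (`hW16`),
Greenberg Thm. 4.1 (`hGr`) and Prop. 3.10 (`h310`), PUBLISHED: if `μ_an ≤ m` (`AnalyticMuLE W p m`),
`λ_an = n` even (`AnalyticLambdaEq W p n`), every `Λ`-divisor of `ϖ·L_p` has `λ ∈ A`
(`AnalyticLamDivisorSet W p A`), `hb : m + 2·ord_p #E(ℚ)_tors < ord_p ∏ c_ℓ + 2·ord_p #Ẽ(𝔽_p)`, and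
the gap check `∀ d ∈ A, Even d → 1 ≤ d → n ≤ d + 1` passes, then `LambdaPartAt W p`.
[cite: GreenbergLNM1716, Prop. 3.10, Thm. 4.1 and §5 p. 183] [cite: Wuthrich2014, Thm. 16 (p. 397)]
[cite: Washington1997, Thm. 7.3 and Prop. 7.6] -/
theorem lambdaPartAt_of_lamDivisorSet_of_even_of_hb
    (hW16 : Wuthrich2014.charIdeal_dvd_padicLFunction) (hGr : greenberg_charValue_rankZero)
    (h310 : prop310_selmerCorank_mod_two_eq_lambdaInvariant)
    (hp : p ≠ 2) (hgood : W.HasGoodReductionAtPrime p) (hord : ¬ (p : ℤ) ∣ W.frobeniusTrace p)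
    (hred : ¬ W.HasIrreducibleModPGaloisRep p) (hL : W.entireLFunction 1 ≠ 0)
    {m n : ℕ} {A : Set ℕ} (hμan : AnalyticMuLE W p m) (hn : Even n) (hlam : AnalyticLambdaEq W p n)
    (hA : AnalyticLamDivisorSet W p A)
    (hb : m + 2 * padicValNat p W.torsionOrder <
      padicValNat p W.tamagawaProduct + 2 * padicValNat p (W.reductionPointCount p))
    (hgap : ∀ d ∈ A, Even d → 1 ≤ d → n ≤ d + 1) : LambdaPartAt W p := by
  intro κ γ hκ hγ hγ' _ f hf ϖ hϖ D g h hchar hι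
  haveI : Module.Finite (IwasawaAlgebra p) D.X := D.module_finite_holds hγ
  obtain ⟨hX, -⟩ := hW16 W p hp ⟨hgood, hord⟩ hred hκ hγ hγ' hf D ϖ hϖ
  have hgh : g * h ≠ 0 := mul_ne_zero_of_iota_eq hgood hord hf hϖ D hι
  have hg : g ≠ 0 := fun h0 ↦ hgh (by rw [h0, zero_mul])
  have h1 : lam (g * h) = n := hlam f hf ϖ hϖ (g * h) hι
  have hμm : mu (g * h) ≤ m := by
    obtain ⟨k, hk⟩ := hμan f hf ϖ hϖ
    rw [← hι] at hk
    exact mu_le_of_lt_norm_coeff hk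
  have h3 : 1 ≤ lam g :=
    one_le_lam_generator_of_hb hGr hp hgood hord hL hκ hγ hγ' hf hϖ D hX hchar hι hμm hb
  -- `Sel_{p^∞}(E/ℚ)` finite from `λ(g) ≠ 0`?  We get it from `g(0) ≠ 0` as in §1; but parity only
  -- needs `corank = 0`, which follows from finiteness; re-derive finiteness via `g(0) ≠ 0`.
  have hordp : IsOrdinaryAt W p := ⟨hgood, hord⟩
  have hg00 : constantCoeff g ≠ 0 := by
    intro h0
    have hc : ((constantCoeff (g * h) : ℤ_[p]) : ℚ_[p]) = 0 := by
      rw [map_mul, h0, zero_mul, PadicInt.coe_zero]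
    rw [← constantCoeff_iwasawaToPowerSeries p (g * h), hι, map_mul, constantCoeff_C,
      constantCoeff_padicLFunction_unitRoot hordp hf] at hc
    have hs0 : ratPlusSymbol f 0 ≠ 0 := by
      intro h0'
      apply hL
      rw [hf.entireLFunction_one_eq, h0']
      simp
    have hϖ0 : ϖ ≠ 0 := varpi_ne_zero hf hϖ
    have h1ne : (1 : ℚ_[p]) - (((unitRoot W p : ℤ_[p]) : ℚ_[p]))⁻¹ ≠ 0 := by
      obtain ⟨u₂, hu₂⟩ := exists_unit_one_sub_unitRoot_inv p W hordp
      rw [hu₂]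
      refine mul_ne_zero (coe_units_ne_zero p u₂) ?_
      exact_mod_cast (W.reductionPointCount_pos p).ne'
    exact mul_ne_zero (by exact_mod_cast hϖ0)
      (mul_ne_zero (pow_ne_zero 2 h1ne) (by exact_mod_cast hs0)) hc
  have hSel : Finite (W.selmerGroupPInfty p) :=
    D.finite_selmerGroupPInfty_of_constantCoeff_ne_zero W hγ hX g hchar hg00
  have hcork : W.selmerCorank p = 0 := by
    haveI := hSel
    exact zpCorank_eq_zero_of_finite (W.selmerGroupPInfty p) p
  have h2 : lam g = lambdaInvariant p D.X := lam_generator_eq_lambdaInvariant D.X hX hg hchar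
  have heven : Even (lam g) := by
    rw [h2]
    exact prop310_selmerCorank_mod_two_eq_lambdaInvariant.even_lambdaInvariant_of_selmerCorank_eq_zero
      h310 W p hp hκ hγ D hX hcork
  have h4 : lam g ∈ A := hA f hf ϖ hϖ g h hι
  have h5 : n ≤ lam g + 1 := hgap (lam g) h4 heven h3
  obtain ⟨a, ha⟩ := heven
  obtain ⟨b, hb2⟩ := hn
  omega

/-- **Route N with `hb`: Mazur's main conjecture** from `μ_an ≤ m`, the μ-part (`MuPartAt W p`),
`λ_an = n` even, the divisor set `A`, `hb` and the `k = 1` gap check. [cite: GreenbergLNM1716, Prop. 3.10, Thm. 4.1]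
[cite: Wuthrich2014, Thm. 16 (p. 397)] [cite: Washington1997, Thm. 7.3 and Prop. 7.6] -/
theorem mazurMainConjecture_of_lamDivisorSet_of_even_of_hb
    (hW16 : Wuthrich2014.charIdeal_dvd_padicLFunction) (hGr : greenberg_charValue_rankZero)
    (h310 : prop310_selmerCorank_mod_two_eq_lambdaInvariant)
    (hp : p ≠ 2) (hgood : W.HasGoodReductionAtPrime p) (hord : ¬ (p : ℤ) ∣ W.frobeniusTrace p)
    (hred : ¬ W.HasIrreducibleModPGaloisRep p) (hL : W.entireLFunction 1 ≠ 0)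
    {m n : ℕ} {A : Set ℕ} (hμan : AnalyticMuLE W p m) (hμ : MuPartAt W p) (hn : Even n)
    (hlam : AnalyticLambdaEq W p n) (hA : AnalyticLamDivisorSet W p A)
    (hb : m + 2 * padicValNat p W.torsionOrder <
      padicValNat p W.tamagawaProduct + 2 * padicValNat p (W.reductionPointCount p))
    (hgap : ∀ d ∈ A, Even d → 1 ≤ d → n ≤ d + 1) : MazurMainConjecture W p :=
  (mazurMainConjecture_iff_muPart_and_lambdaPart hW16 hp hgood hord hred).mpr
    ⟨hμ, lambdaPartAt_of_lamDivisorSet_of_even_of_hb hW16 hGr h310 hp hgood hord hred hL hμan hn hlam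
      hA hb hgap⟩

end Squeeze

/-! ## §3. On the leaf X1 ∩ {r = 0}: route N closures from the pattern and `hb` alone -/

section Leaf

variable {W : WeierstrassCurve ℚ} [W.IsElliptic] [W.IsGloballyMinimal] {p : ℕ} [Fact p.Prime]

/-- **Route N with `hb` on the leaf (general `μ_an ≤ m` form): `AnalyticMuLE m ∧ MuPartAt ∧ λ_an = n ∧
(divisor set A) ∧ hb ∧ gap ⇒ BSD(E,p)`** (`λ_an` even by `ParitySqueeze.Leaf.even_of_analyticLambdaEq`;
`L(E,1) ≠ 0` from `r_an = 0` by modularity). [cite: GreenbergLNM1716, Prop. 3.10, Thm. 4.1, §5 p. 183]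
[cite: Wuthrich2014, Thm. 16 (p. 397)] [cite: Washington1997, Thm. 7.3 and Prop. 7.6] -/
theorem Leaf.bsdp_of_lamDivisorSet_of_hb
    (hW16 : Wuthrich2014.charIdeal_dvd_padicLFunction) (hGr : greenberg_charValue_rankZero)
    (h310 : prop310_selmerCorank_mod_two_eq_lambdaInvariant)
    (hmod : nonempty_modularParametrizationData)
    (hGZK : rank_eq_analyticRank_of_analyticRank_le_one) (hL : RankZero.Leaf W p)
    {m n : ℕ} {A : Set ℕ} (hμan : AnalyticMuLE W p m) (hμ : MuPartAt W p)
    (hlam : AnalyticLambdaEq W p n) (hA : AnalyticLamDivisorSet W p A)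
    (hb : m + 2 * padicValNat p W.torsionOrder <
      padicValNat p W.tamagawaProduct + 2 * padicValNat p (W.reductionPointCount p))
    (hgap : ∀ d ∈ A, Even d → 1 ≤ d → n ≤ d + 1) : BSDp W p :=
  have hX := isClassX1_of_classX1 hL.classX1
  (RankZero.Leaf.mazurMainConjecture_iff_bsdp hW16 hGr hmod hGZK hL).mp
    (mazurMainConjecture_of_lamDivisorSet_of_even_of_hb hW16 hGr h310 hX.two_ne
      hX.hasGoodReductionAtPrime hX.not_dvd_frobeniusTrace hX.not_hasIrreducibleModPGaloisRep
      (entireLFunction_one_ne_zero_of_analyticRank_eq_zero hmod W hL.analyticRank_eq_zero) hμan hμ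
      (ParitySqueeze.Leaf.even_of_analyticLambdaEq hW16 hmod hL hlam) hlam hA hb hgap)

/-- **Route N with `hb` at the `μ = 0` member: `μ_an = 0 ∧ λ_an = n ∧ (divisor set A) ∧
2·ord_p #E(ℚ)_tors < ord_p ∏ c_ℓ + 2·ord_p #Ẽ(𝔽_p) ∧ gap ⇒ BSD(E,p)`** on the leaf (μ-part
automatic, `MuPart.muPartAt_of_analyticMuLE_zero`). [cite: GreenbergLNM1716, Prop. 3.10, Thm. 4.1, §5 p. 183]
[cite: Wuthrich2014, Thm. 16 (p. 397)] [cite: Washington1997, Thm. 7.3 and Prop. 7.6] -/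
theorem Leaf.bsdp_of_muZero_of_lamDivisorSet_of_hb
    (hW16 : Wuthrich2014.charIdeal_dvd_padicLFunction) (hGr : greenberg_charValue_rankZero)
    (h310 : prop310_selmerCorank_mod_two_eq_lambdaInvariant)
    (hmod : nonempty_modularParametrizationData)
    (hGZK : rank_eq_analyticRank_of_analyticRank_le_one) (hL : RankZero.Leaf W p)
    (hμ0 : AnalyticMuLE W p 0) {n : ℕ} {A : Set ℕ} (hlam : AnalyticLambdaEq W p n)
    (hA : AnalyticLamDivisorSet W p A)
    (hb : 2 * padicValNat p W.torsionOrder <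
      padicValNat p W.tamagawaProduct + 2 * padicValNat p (W.reductionPointCount p))
    (hgap : ∀ d ∈ A, Even d → 1 ≤ d → n ≤ d + 1) : BSDp W p :=
  have hX := isClassX1_of_classX1 hL.classX1
  Leaf.bsdp_of_lamDivisorSet_of_hb hW16 hGr h310 hmod hGZK hL hμ0
    (muPartAt_of_analyticMuLE_zero hW16 hX.two_ne hX.hasGoodReductionAtPrime
      hX.not_dvd_frobeniusTrace hX.not_hasIrreducibleModPGaloisRep hμ0) hlam hA (by simpa using hb) hgap

/-- **The irreducible case with `hb`: `μ_an = 0`, `λ_an = n`, every `Λ`-divisor of `ϖ·L_p` has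
`λ ∈ {0, n}` (`P_an` irreducible over `ℚ_p`), and `2·ord_p #E(ℚ)_tors < ord_p ∏ c_ℓ + 2·ord_p #Ẽ(𝔽_p)`
⇒ `BSD(E,p)`** — no typed lower bound (the N1″ cell `448286d@5`, `λ_an = 4`, `P_an` irreducible,
`#E(ℚ)_tors = 5`, `∏ c_ℓ = 225`, is of this shape; so are 480 of the gen-10 route-N closures).
[cite: GreenbergLNM1716, Thm. 4.1, §5 pp. 131, 183] [cite: Wuthrich2014, Thm. 16 (p. 397)] -/
theorem Leaf.bsdp_of_muZero_of_irreducible_of_hb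
    (hW16 : Wuthrich2014.charIdeal_dvd_padicLFunction) (hGr : greenberg_charValue_rankZero)
    (h310 : prop310_selmerCorank_mod_two_eq_lambdaInvariant)
    (hmod : nonempty_modularParametrizationData)
    (hGZK : rank_eq_analyticRank_of_analyticRank_le_one) (hL : RankZero.Leaf W p)
    (hμ0 : AnalyticMuLE W p 0) {n : ℕ} (hlam : AnalyticLambdaEq W p n)
    (hA : AnalyticLamDivisorSet W p {0, n})
    (hb : 2 * padicValNat p W.torsionOrder <
      padicValNat p W.tamagawaProduct + 2 * padicValNat p (W.reductionPointCount p)) : BSDp W p := by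
  refine Leaf.bsdp_of_muZero_of_lamDivisorSet_of_hb hW16 hGr h310 hmod hGZK hL hμ0 hlam hA hb ?_
  intro d hd _ h1
  rcases hd with rfl | rfl
  · exact absurd h1 (by omega)
  · omega

/-- **The irreducible case, `p ∣ ∏ c_ℓ` and `p² ∤ #E(ℚ)_tors`** (`hb` from the anomalous prime).
[cite: GreenbergLNM1716, Thm. 4.1, §5 pp. 131, 183] [cite: Wuthrich2014, Thm. 16 (p. 397)] -/
theorem Leaf.bsdp_of_muZero_of_irreducible_of_dvd_tamagawaProduct
    (hW16 : Wuthrich2014.charIdeal_dvd_padicLFunction) (hGr : greenberg_charValue_rankZero)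
    (h310 : prop310_selmerCorank_mod_two_eq_lambdaInvariant)
    (hmod : nonempty_modularParametrizationData)
    (hGZK : rank_eq_analyticRank_of_analyticRank_le_one) (hL : RankZero.Leaf W p)
    (htors : ¬ p ^ 2 ∣ W.torsionOrder) (htam : p ∣ W.tamagawaProduct)
    (hμ0 : AnalyticMuLE W p 0) {n : ℕ} (hlam : AnalyticLambdaEq W p n)
    (hA : AnalyticLamDivisorSet W p {0, n}) : BSDp W p := by
  refine Leaf.bsdp_of_muZero_of_irreducible_of_hb hW16 hGr h310 hmod hGZK hL hμ0 hlam hA ?_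
  have h1 := ParitySqueeze.Leaf.one_le_padicValNat_reductionPointCount hL
  have htam0 : W.tamagawaProduct ≠ 0 := (W.tamagawaProduct_pos').ne'
  have h2 : 1 ≤ padicValNat p W.tamagawaProduct := one_le_padicValNat_of_dvd htam0 htam
  have h3 : padicValNat p W.torsionOrder ≤ 1 := by
    by_contra hlt
    push Not at hlt
    exact htors ((padicValNat_dvd_iff_le (W.torsionOrder_pos_holds).ne').mpr hlt)
  omega

/-- **The irreducible case, `p ∤ #E(ℚ)_tors`** (`hb` automatic: `2·ord_p #Ẽ(𝔽_p) ≥ 2`).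
[cite: GreenbergLNM1716, Thm. 4.1, §5 pp. 131, 183] [cite: Wuthrich2014, Thm. 16 (p. 397)] -/
theorem Leaf.bsdp_of_muZero_of_irreducible_of_not_dvd_torsionOrder
    (hW16 : Wuthrich2014.charIdeal_dvd_padicLFunction) (hGr : greenberg_charValue_rankZero)
    (h310 : prop310_selmerCorank_mod_two_eq_lambdaInvariant)
    (hmod : nonempty_modularParametrizationData)
    (hGZK : rank_eq_analyticRank_of_analyticRank_le_one) (hL : RankZero.Leaf W p)
    (htors : ¬ p ∣ W.torsionOrder) (hμ0 : AnalyticMuLE W p 0) {n : ℕ}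
    (hlam : AnalyticLambdaEq W p n) (hA : AnalyticLamDivisorSet W p {0, n}) : BSDp W p := by
  refine Leaf.bsdp_of_muZero_of_irreducible_of_hb hW16 hGr h310 hmod hGZK hL hμ0 hlam hA ?_
  have h0 : padicValNat p W.torsionOrder = 0 := padicValNat.eq_zero_of_not_dvd htors
  have h1 := ParitySqueeze.Leaf.one_le_padicValNat_reductionPointCount hL
  omega

end Leaf

end Summit.BirchSwinnertonDyer.Rank1Residual.X1.FactorSqueezeHb

end
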